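import Literature.MathematicalPhysics.QuantumLattice.HubbardNNNHoppingClusterLowerBound2x3
import HarnessLib

/-!
# The WEIGHTED open `r × c` cluster of the `t–t'–U` Hubbard model (position-dependent bond and site
# weights, on-site potentials): the cluster Hamiltonian of the weighted Anderson cover

Topic `MathematicalPhysics/QuantumLattice`, family `hubbard` (seat hubbard-box-p3, S2 CERTIFIER-FAMILIES,
hypothesis-free tier). The uniform open-box Hamiltonian `hubbardOpenBoxTT' r c t₁ t₁' U₁`
(`HubbardNNNHoppingOpenClusters.lean`) gives Anderson's cluster lower bound with the UNIFORM cover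
(`ClusterLowerBound.energyDensityTT'_ge_of_boxFloors_2x3`: `(7t₁, 4t₁', 12U₁) = (t, t', U)`).
Valentí–Stolze–Hirschfeld (1991, §II) observed that the decomposition `H = Σ_clusters h` remains an
identity when the amplitude of a lattice bond (resp. the repulsion of a site) is distributed UNEQUALLY
among the translated clusters covering it, as long as the weights of all covering (cluster, position)
pairs add up to the lattice amplitude; the resulting bound `E₀(H) ≥ Σ E₀(h)` is concave in the weights
and strictly better than the uniform one for every box larger than the plaquette. This file defines the
weighted cluster Hamiltonian on the site type `Fin r ×ₗ Fin c` of the tree's open boxes,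

  `h^W = -Σ_{x ~ y or x ~~ y} Σ_σ τ(x,y) c†_{xσ} c_{yσ} + Σ_x υ(x) n_{x↑} n_{x↓} + Σ_x ν(x) (n_{x↑} + n_{x↓})`

(`hubbardOpenBoxTT'W r c τ υ ν`; `~` nearest-neighbour, `~~` diagonal adjacency of the open box; `τ`
symmetric real bond weights, `υ` site repulsions, `ν` on-site potentials), the four DIRECTIONAL WEIGHT
SUMS that enter the cover identity (`wsumV`, `wsumH`, `wsumD₁`, `wsumD₂`: total weight of the bonds
`(i,j)→(i+1,j)`, `(i,j)→(i,j+1)`, `(i,j)→(i+1,j+1)`, `(i,j+1)→(i+1,j)`), and proves: the uniform case is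
`hubbardOpenBoxTT'` (`hubbardOpenBoxTT'W_uniform`); `h^W` is Hermitian for symmetric `τ` and conserves
`N↑`, `N↓` (`hubbardOpenBoxTT'W_isHermitian`, `preservesSectors_hubbardOpenBoxTT'W`,
`hubbardOpenBoxTT'W_commute_totalNumber`); the coordinate swap carries the weighted `r × c` box onto the
weighted `c × r` box with transposed weights, so their sector ground-state energies agree
(`relabel_rectSwap_hubbardOpenBoxTT'W`, `groundEnergy_hubbardOpenBoxTT'W_swap`) and the directional sums
are exchanged accordingly (`wsumV_transpose`, …). The cover identity and the lower bound are in
`HubbardNNNHoppingWeightedClusterLowerBound.lean`.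

References: P. W. Anderson, Phys. Rev. 83 (1951) 1260, eq. (2) [cite: Anderson1951, eq. (2)];
R. Valentí, J. Stolze, P. J. Hirschfeld, Phys. Rev. B 43 (1991) 13743, §II (weighted clusters)
[cite: ValentiStolzeHirschfeld1991, §II]; Bratteli–Robinson II §5.2.2 (covariance of second quantisation
under site bijections) [cite: BratteliRobinsonII1997, §5.2.2]. Everything is proved; the five definitions
have bodies; no named facts; no instances, no notation.
-/

noncomputable section

namespace Literature.MathematicalPhysics.QuantumLattice

open Matrix Finset HubbardWave0
open scoped ComplexOrder

namespace ClusterLowerBound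

variable {r c : ℕ}

/-! ### §1. The weighted open box -/

/-- **The weighted open `r × c` cluster Hamiltonian of the `t–t'–U` Hubbard model**:
`h^W = -Σ_{x ~ y or x ~~ y} Σ_σ τ(x,y) c†_{xσ} c_{yσ} + Σ_x υ(x) n_{x↑}n_{x↓} + Σ_x ν(x) (n_{x↑} + n_{x↓})`
with position-dependent bond weights `τ` (nearest-neighbour and diagonal bonds of the open box), site
repulsions `υ` and on-site potentials `ν` — the cluster Hamiltonian of the weighted Anderson cover.
[cite: ValentiStolzeHirschfeld1991, §II] -/
def hubbardOpenBoxTT'W (r c : ℕ) (τ : Fin r ×ₗ Fin c → Fin r ×ₗ Fin c → ℝ) (υ ν : Fin r ×ₗ Fin c → ℝ) :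
    Matrix (Finset (Orb (Fin r ×ₗ Fin c))) (Finset (Orb (Fin r ×ₗ Fin c))) ℂ :=
  -(∑ x : Fin r ×ₗ Fin c, ∑ y : Fin r ×ₗ Fin c, ∑ σ : Fin 2,
      if (rectBoxGraph r c).Adj x y ∨ (rectBoxDiagGraph r c).Adj x y then
        ((τ x y : ℝ) : ℂ) • (creation (orb x σ) * annihilation (orb y σ)) else 0) +
    ∑ x : Fin r ×ₗ Fin c, ((υ x : ℝ) : ℂ) • (numberOp x 0 * numberOp x 1) +
    ∑ x : Fin r ×ₗ Fin c, ((ν x : ℝ) : ℂ) • (numberOp x 0 + numberOp x 1)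

/-- **Total weight of the `+e₁` bonds** `(i, j) → (i+1, j)` of the weighted box. [cite: ValentiStolzeHirschfeld1991, §II] -/
def wsumV (τ : Fin r ×ₗ Fin c → Fin r ×ₗ Fin c → ℝ) : ℝ :=
  ∑ p : Fin r ×ₗ Fin c, ∑ q : Fin r ×ₗ Fin c,
    if ((ofLex p).1 : ℕ) + 1 = (ofLex q).1 ∧ (ofLex p).2 = (ofLex q).2 then τ p q else 0

/-- **Total weight of the `+e₂` bonds** `(i, j) → (i, j+1)`. [cite: ValentiStolzeHirschfeld1991, §II] -/
def wsumH (τ : Fin r ×ₗ Fin c → Fin r ×ₗ Fin c → ℝ) : ℝ :=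
  ∑ p : Fin r ×ₗ Fin c, ∑ q : Fin r ×ₗ Fin c,
    if (ofLex p).1 = (ofLex q).1 ∧ ((ofLex p).2 : ℕ) + 1 = (ofLex q).2 then τ p q else 0

/-- **Total weight of the `e₁ + e₂` diagonal bonds** `(i, j) → (i+1, j+1)`. [cite: ValentiStolzeHirschfeld1991, §II] -/
def wsumD₁ (τ : Fin r ×ₗ Fin c → Fin r ×ₗ Fin c → ℝ) : ℝ :=
  ∑ p : Fin r ×ₗ Fin c, ∑ q : Fin r ×ₗ Fin c,
    if ((ofLex p).1 : ℕ) + 1 = (ofLex q).1 ∧ ((ofLex p).2 : ℕ) + 1 = (ofLex q).2 then τ p q else 0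

/-- **Total weight of the `e₁ - e₂` diagonal bonds** `(i, j+1) → (i+1, j)`. [cite: ValentiStolzeHirschfeld1991, §II] -/
def wsumD₂ (τ : Fin r ×ₗ Fin c → Fin r ×ₗ Fin c → ℝ) : ℝ :=
  ∑ p : Fin r ×ₗ Fin c, ∑ q : Fin r ×ₗ Fin c,
    if ((ofLex p).1 : ℕ) + 1 = (ofLex q).1 ∧ ((ofLex q).2 : ℕ) + 1 = (ofLex p).2 then τ p q else 0

/-- Nearest-neighbour and diagonal (next-nearest-neighbour) bonds of the open `t–t'` box are distinct bond
classes: the two adjacencies exclude each other. [cite: LeBlancEtAl2015, eq. (1)] -/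
theorem not_rectBoxDiagGraph_adj_of_rectBoxGraph_adj {x y : Fin r ×ₗ Fin c} (h : (rectBoxGraph r c).Adj x y) :
    ¬(rectBoxDiagGraph r c).Adj x y := by
  intro h'
  change ((ofLex x).2 = (ofLex y).2 ∧ lineAdj (ofLex x).1 (ofLex y).1) ∨
    ((ofLex x).1 = (ofLex y).1 ∧ lineAdj (ofLex x).2 (ofLex y).2) at h
  change lineAdj (ofLex x).1 (ofLex y).1 ∧ lineAdj (ofLex x).2 (ofLex y).2 at h'
  unfold lineAdj at h h'
  rcases h with ⟨h1, _⟩ | ⟨h1, _⟩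
  · have := congrArg Fin.val h1; omega
  · have := congrArg Fin.val h1; omega

/-- **The uniform weights give the tree's open box**: with `τ = t` on nearest-neighbour bonds, `τ = t'`
on diagonal bonds, `υ = U`, `ν = 0`, `h^W = hubbardOpenBoxTT' r c t t' U`. [cite: LeBlancEtAl2015, eq. (1)] -/
theorem hubbardOpenBoxTT'W_uniform (r c : ℕ) (t t' U : ℝ) :
    hubbardOpenBoxTT'W r c (fun x y => if (rectBoxGraph r c).Adj x y then t else t') (fun _ => U) (fun _ => 0) =
      hubbardOpenBoxTT' r c t t' U := by
  have key : ∀ x y : Fin r ×ₗ Fin c, ∀ σ : Fin 2,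
      (if (rectBoxGraph r c).Adj x y ∨ (rectBoxDiagGraph r c).Adj x y then
        (((if (rectBoxGraph r c).Adj x y then t else t' : ℝ)) : ℂ) •
          (creation (orb x σ) * annihilation (orb y σ)) else (0 : Matrix _ _ ℂ)) =
      (t : ℂ) • (if (rectBoxGraph r c).Adj x y then creation (orb x σ) * annihilation (orb y σ) else 0) +
        (t' : ℂ) • (if (rectBoxDiagGraph r c).Adj x y then creation (orb x σ) * annihilation (orb y σ) else 0) := by
    intro x y σ
    by_cases h1 : (rectBoxGraph r c).Adj x y
    · rw [if_pos (Or.inl h1), if_pos h1, if_pos h1, if_neg (not_rectBoxDiagGraph_adj_of_rectBoxGraph_adj h1),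
        smul_zero, add_zero]
    · by_cases h2 : (rectBoxDiagGraph r c).Adj x y
      · rw [if_pos (Or.inr h2), if_neg h1, if_neg h1, if_pos h2, smul_zero, zero_add]
      · rw [if_neg (fun h => h.elim h1 h2), if_neg h1, if_neg h2, smul_zero, smul_zero, add_zero]
  have hsum : (∑ x : Fin r ×ₗ Fin c, ∑ y : Fin r ×ₗ Fin c, ∑ σ : Fin 2,
      if (rectBoxGraph r c).Adj x y ∨ (rectBoxDiagGraph r c).Adj x y then
        (((if (rectBoxGraph r c).Adj x y then t else t' : ℝ)) : ℂ) •
          (creation (orb x σ) * annihilation (orb y σ)) else (0 : Matrix _ _ ℂ)) =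
      (t : ℂ) • (∑ x : Fin r ×ₗ Fin c, ∑ y : Fin r ×ₗ Fin c, ∑ σ : Fin 2,
          if (rectBoxGraph r c).Adj x y then creation (orb x σ) * annihilation (orb y σ) else 0) +
        (t' : ℂ) • (∑ x : Fin r ×ₗ Fin c, ∑ y : Fin r ×ₗ Fin c, ∑ σ : Fin 2,
          if (rectBoxDiagGraph r c).Adj x y then creation (orb x σ) * annihilation (orb y σ) else 0) := by
    rw [Finset.smul_sum, Finset.smul_sum, ← Finset.sum_add_distrib]
    refine Finset.sum_congr rfl fun x _ => ?_
    rw [Finset.smul_sum, Finset.smul_sum, ← Finset.sum_add_distrib]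
    refine Finset.sum_congr rfl fun y _ => ?_
    rw [Finset.smul_sum, Finset.smul_sum, ← Finset.sum_add_distrib]
    exact Finset.sum_congr rfl fun σ _ => key x y σ
  unfold hubbardOpenBoxTT'W hubbardOpenBoxTT' hamiltonian
  dsimp only
  rw [hsum, ← Finset.smul_sum]
  simp only [Complex.ofReal_zero, zero_smul, Finset.sum_const_zero, add_zero]
  module

/-! ### §2. Hermiticity and particle-number conservation -/

/-- **`h^W` is Hermitian** for symmetric real weights (the hopping sum over ordered pairs contains each
term with its adjoint). [cite: LiebPRL1989, eq. (1)] -/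
theorem hubbardOpenBoxTT'W_isHermitian (τ : Fin r ×ₗ Fin c → Fin r ×ₗ Fin c → ℝ) (hτ : ∀ x y, τ x y = τ y x)
    (υ ν : Fin r ×ₗ Fin c → ℝ) : (hubbardOpenBoxTT'W r c τ υ ν).IsHermitian := by
  have hA : ∀ x y : Fin r ×ₗ Fin c, ((rectBoxGraph r c).Adj x y ∨ (rectBoxDiagGraph r c).Adj x y) →
      ((rectBoxGraph r c).Adj y x ∨ (rectBoxDiagGraph r c).Adj y x) :=
    fun x y h => h.elim (fun h => Or.inl h.symm) (fun h => Or.inr h.symm)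
  have hT : (∑ x : Fin r ×ₗ Fin c, ∑ y : Fin r ×ₗ Fin c, ∑ σ : Fin 2,
      (if (rectBoxGraph r c).Adj x y ∨ (rectBoxDiagGraph r c).Adj x y then
        ((τ x y : ℝ) : ℂ) • (creation (orb x σ) * annihilation (orb y σ))
        else (0 : Matrix (Finset (Orb (Fin r ×ₗ Fin c))) (Finset (Orb (Fin r ×ₗ Fin c))) ℂ)))ᴴ =
      ∑ x : Fin r ×ₗ Fin c, ∑ y : Fin r ×ₗ Fin c, ∑ σ : Fin 2,
        (if (rectBoxGraph r c).Adj x y ∨ (rectBoxDiagGraph r c).Adj x y then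
          ((τ x y : ℝ) : ℂ) • (creation (orb x σ) * annihilation (orb y σ)) else 0) := by
    simp only [conjTranspose_sum]
    rw [Finset.sum_comm]
    refine Finset.sum_congr rfl fun a _ => Finset.sum_congr rfl fun b _ =>
      Finset.sum_congr rfl fun σ _ => ?_
    by_cases h : (rectBoxGraph r c).Adj b a ∨ (rectBoxDiagGraph r c).Adj b a
    · rw [if_pos h, if_pos (hA b a h), conjTranspose_smul, conjTranspose_mul, creation, creation,
        conjTranspose_conjTranspose, hτ a b, Complex.star_def, Complex.conj_ofReal]
    · rw [if_neg h, if_neg (fun h' => h (hA a b h')), conjTranspose_zero]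
  have hV : (∑ x : Fin r ×ₗ Fin c, ((υ x : ℝ) : ℂ) •
      (numberOp x 0 * numberOp x 1 : Matrix (Finset (Orb (Fin r ×ₗ Fin c))) (Finset (Orb (Fin r ×ₗ Fin c))) ℂ))ᴴ =
      ∑ x : Fin r ×ₗ Fin c, ((υ x : ℝ) : ℂ) • (numberOp x 0 * numberOp x 1) := by
    rw [conjTranspose_sum]
    refine Finset.sum_congr rfl fun x _ => ?_
    rw [conjTranspose_smul, conjTranspose_mul, Complex.star_def, Complex.conj_ofReal]
    change _ • ((numberAt (orb x 1))ᴴ * (numberAt (orb x 0))ᴴ) = _ • (numberAt (orb x 0) * numberAt (orb x 1))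
    rw [(numberAt_isHermitian _).eq, (numberAt_isHermitian _).eq, (numberAt_commute _ _).eq]
  have hN : (∑ x : Fin r ×ₗ Fin c, ((ν x : ℝ) : ℂ) •
      (numberOp x 0 + numberOp x 1 : Matrix (Finset (Orb (Fin r ×ₗ Fin c))) (Finset (Orb (Fin r ×ₗ Fin c))) ℂ))ᴴ =
      ∑ x : Fin r ×ₗ Fin c, ((ν x : ℝ) : ℂ) • (numberOp x 0 + numberOp x 1) := by
    rw [conjTranspose_sum]
    refine Finset.sum_congr rfl fun x _ => ?_
    rw [conjTranspose_smul, conjTranspose_add, Complex.star_def, Complex.conj_ofReal]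
    change _ • ((numberAt (orb x 0))ᴴ + (numberAt (orb x 1))ᴴ) = _ • (numberAt (orb x 0) + numberAt (orb x 1))
    rw [(numberAt_isHermitian _).eq, (numberAt_isHermitian _).eq]
  unfold hubbardOpenBoxTT'W
  rw [IsHermitian, conjTranspose_add, conjTranspose_add, conjTranspose_neg, hT, hV, hN]

/-- Negatives of sector-preserving matrices preserve sectors. [folklore] -/
private theorem preservesSectors_neg' {Λ : Type*} [LinearOrder Λ] [Fintype Λ]
    {M : Matrix (Finset (Orb Λ)) (Finset (Orb Λ)) ℂ} (hM : PreservesSectors M) : PreservesSectors (-M) := by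
  have h := hM.smul (-1 : ℂ)
  rwa [neg_one_smul] at h

/-- **`h^W` conserves `N↑` and `N↓`** (spin-diagonal hoppings, occupation-number interactions).
[cite: LiebPRL1989, eqs. (1)–(2)] -/
theorem preservesSectors_hubbardOpenBoxTT'W (τ : Fin r ×ₗ Fin c → Fin r ×ₗ Fin c → ℝ) (υ ν : Fin r ×ₗ Fin c → ℝ) :
    PreservesSectors (hubbardOpenBoxTT'W r c τ υ ν) := by
  unfold hubbardOpenBoxTT'W
  refine ((preservesSectors_neg' (PreservesSectors.sum fun x _ => PreservesSectors.sum fun y _ =>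
    PreservesSectors.sum fun σ _ => ((LiebThm1.preservesSectors_hopping x y σ).smul _).ite _)).add
      (PreservesSectors.sum fun x _ => ((LiebThm1.preservesSectors_numberOp x 0).mul
        (LiebThm1.preservesSectors_numberOp x 1)).smul _)).add
      (PreservesSectors.sum fun x _ => ((LiebThm1.preservesSectors_numberOp x 0).add
        (LiebThm1.preservesSectors_numberOp x 1)).smul _)

/-- **`[h^W, N̂] = 0`.** [cite: LiebPRL1989, eqs. (1)–(2)] -/
theorem hubbardOpenBoxTT'W_commute_totalNumber (τ : Fin r ×ₗ Fin c → Fin r ×ₗ Fin c → ℝ) (υ ν : Fin r ×ₗ Fin c → ℝ) :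
    Commute (hubbardOpenBoxTT'W r c τ υ ν) totalNumber := by
  rw [LiebThm1.totalNumber_eq_diagonal]
  exact (preservesSectors_hubbardOpenBoxTT'W τ υ ν).commute_diagonal fun a b => ((a + b : ℕ) : ℂ)

/-! ### §3. Transposition covariance -/

/-- Nearest-neighbour adjacency is carried by the coordinate swap. [folklore] -/
private theorem rectBoxGraph_adj_rectSwap (x y : Fin r ×ₗ Fin c) :
    (rectBoxGraph c r).Adj (rectSwap r c x) (rectSwap r c y) ↔ (rectBoxGraph r c).Adj x y := by
  show ((ofLex x).1 = (ofLex y).1 ∧ lineAdj (ofLex x).2 (ofLex y).2) ∨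
      ((ofLex x).2 = (ofLex y).2 ∧ lineAdj (ofLex x).1 (ofLex y).1) ↔
    ((ofLex x).2 = (ofLex y).2 ∧ lineAdj (ofLex x).1 (ofLex y).1) ∨
      ((ofLex x).1 = (ofLex y).1 ∧ lineAdj (ofLex x).2 (ofLex y).2)
  exact Or.comm

/-- Diagonal adjacency is carried by the coordinate swap. [folklore] -/
private theorem rectBoxDiagGraph_adj_rectSwap (x y : Fin r ×ₗ Fin c) :
    (rectBoxDiagGraph c r).Adj (rectSwap r c x) (rectSwap r c y) ↔ (rectBoxDiagGraph r c).Adj x y := by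
  show lineAdj (ofLex x).2 (ofLex y).2 ∧ lineAdj (ofLex x).1 (ofLex y).1 ↔
    lineAdj (ofLex x).1 (ofLex y).1 ∧ lineAdj (ofLex x).2 (ofLex y).2
  exact And.comm

/-- **Covariance of the weighted box under the coordinate swap**: relabelling the orbitals along
`rectSwap r c` carries `h^W_{r×c}(τ, υ, ν)` onto `h^W_{c×r}(τᵀ, υᵀ, νᵀ)` with the transposed weights
`τᵀ p q = τ (swap p) (swap q)`, `υᵀ = υ ∘ swap`, `νᵀ = ν ∘ swap`. [cite: BratteliRobinsonII1997, §5.2.2] -/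
theorem relabel_rectSwap_hubbardOpenBoxTT'W (τ : Fin r ×ₗ Fin c → Fin r ×ₗ Fin c → ℝ) (υ ν : Fin r ×ₗ Fin c → ℝ) :
    relabel (Orb.mapEquiv (rectSwap r c)) (hubbardOpenBoxTT'W r c τ υ ν) =
      hubbardOpenBoxTT'W c r (fun p q => τ (rectSwap c r p) (rectSwap c r q)) (fun p => υ (rectSwap c r p))
        (fun p => ν (rectSwap c r p)) := by
  unfold hubbardOpenBoxTT'W
  rw [map_add, map_add, map_neg, map_sum, map_sum, map_sum]
  congr 1
  congr 1
  · congr 1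
    rw [← (rectSwap r c).sum_comp]
    refine Finset.sum_congr rfl fun x _ => ?_
    rw [map_sum, ← (rectSwap r c).sum_comp]
    refine Finset.sum_congr rfl fun y _ => ?_
    rw [map_sum]
    refine Finset.sum_congr rfl fun σ _ => ?_
    have hx : rectSwap c r (rectSwap r c x) = x := rfl
    have hy : rectSwap c r (rectSwap r c y) = y := rfl
    by_cases h : (rectBoxGraph r c).Adj x y ∨ (rectBoxDiagGraph r c).Adj x y
    · have h' : (rectBoxGraph c r).Adj (rectSwap r c x) (rectSwap r c y) ∨
          (rectBoxDiagGraph c r).Adj (rectSwap r c x) (rectSwap r c y) :=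
        h.elim (fun h => Or.inl ((rectBoxGraph_adj_rectSwap x y).2 h))
          (fun h => Or.inr ((rectBoxDiagGraph_adj_rectSwap x y).2 h))
      rw [if_pos h, if_pos h', map_smul, map_mul, relabel_creation, relabel_annihilation, Orb.mapEquiv_orb,
        Orb.mapEquiv_orb]
      simp only [hx, hy]
    · have h' : ¬((rectBoxGraph c r).Adj (rectSwap r c x) (rectSwap r c y) ∨
          (rectBoxDiagGraph c r).Adj (rectSwap r c x) (rectSwap r c y)) := fun h'' =>
        h (h''.elim (fun h => Or.inl ((rectBoxGraph_adj_rectSwap x y).1 h))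
          (fun h => Or.inr ((rectBoxDiagGraph_adj_rectSwap x y).1 h)))
      rw [if_neg h, if_neg h', map_zero]
  · rw [← (rectSwap r c).sum_comp]
    refine Finset.sum_congr rfl fun x _ => ?_
    have hx : rectSwap c r (rectSwap r c x) = x := rfl
    rw [map_smul, map_mul, relabel_mapEquiv_numberOp, relabel_mapEquiv_numberOp]
    simp only [hx]
  · rw [← (rectSwap r c).sum_comp]
    refine Finset.sum_congr rfl fun x _ => ?_
    have hx : rectSwap c r (rectSwap r c x) = x := rfl
    rw [map_smul, map_add, relabel_mapEquiv_numberOp, relabel_mapEquiv_numberOp]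
    simp only [hx]

/-- **One table serves both orientations**: the sector ground-state energies of the weighted `c × r` box
with transposed weights are those of the weighted `r × c` box. [cite: BratteliRobinsonII1997, §5.2.2] -/
theorem groundEnergy_hubbardOpenBoxTT'W_swap (τ : Fin r ×ₗ Fin c → Fin r ×ₗ Fin c → ℝ) (υ ν : Fin r ×ₗ Fin c → ℝ)
    (N : ℕ) :
    groundEnergy (hubbardOpenBoxTT'W c r (fun p q => τ (rectSwap c r p) (rectSwap c r q))
        (fun p => υ (rectSwap c r p)) (fun p => ν (rectSwap c r p))) N =
      groundEnergy (hubbardOpenBoxTT'W r c τ υ ν) N := by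
  rw [← relabel_rectSwap_hubbardOpenBoxTT'W, groundEnergy_relabel]

/-! ### §4. The directional weight sums under transposition and reversal -/

/-- Sums over the `c × r` box re-indexed over the `r × c` box. [folklore] -/
private theorem sum_sum_rectSwap {M : Type*} [AddCommMonoid M] (F : Fin c ×ₗ Fin r → Fin c ×ₗ Fin r → M) :
    ∑ p : Fin c ×ₗ Fin r, ∑ q : Fin c ×ₗ Fin r, F p q =
      ∑ p : Fin r ×ₗ Fin c, ∑ q : Fin r ×ₗ Fin c, F (rectSwap r c p) (rectSwap r c q) := by
  rw [← (rectSwap r c).sum_comp]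
  exact Finset.sum_congr rfl fun p _ => by rw [← (rectSwap r c).sum_comp]

/-- `wsumV (τᵀ) = wsumH τ`: the `+e₁` bonds of the transposed box are the `+e₂` bonds of the box.
[cite: ValentiStolzeHirschfeld1991, §II] -/
theorem wsumV_transpose (τ : Fin r ×ₗ Fin c → Fin r ×ₗ Fin c → ℝ) :
    wsumV (fun p q : Fin c ×ₗ Fin r => τ (rectSwap c r p) (rectSwap c r q)) = wsumH τ := by
  unfold wsumV wsumH
  rw [sum_sum_rectSwap]
  refine Finset.sum_congr rfl fun p _ => Finset.sum_congr rfl fun q _ => ?_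
  exact if_congr and_comm rfl rfl

/-- `wsumH (τᵀ) = wsumV τ`. [cite: ValentiStolzeHirschfeld1991, §II] -/
theorem wsumH_transpose (τ : Fin r ×ₗ Fin c → Fin r ×ₗ Fin c → ℝ) :
    wsumH (fun p q : Fin c ×ₗ Fin r => τ (rectSwap c r p) (rectSwap c r q)) = wsumV τ := by
  unfold wsumV wsumH
  rw [sum_sum_rectSwap]
  refine Finset.sum_congr rfl fun p _ => Finset.sum_congr rfl fun q _ => ?_
  exact if_congr and_comm rfl rfl

/-- `wsumD₁ (τᵀ) = wsumD₁ τ`. [cite: ValentiStolzeHirschfeld1991, §II] -/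
theorem wsumD₁_transpose (τ : Fin r ×ₗ Fin c → Fin r ×ₗ Fin c → ℝ) :
    wsumD₁ (fun p q : Fin c ×ₗ Fin r => τ (rectSwap c r p) (rectSwap c r q)) = wsumD₁ τ := by
  unfold wsumD₁
  rw [sum_sum_rectSwap]
  refine Finset.sum_congr rfl fun p _ => Finset.sum_congr rfl fun q _ => ?_
  exact if_congr and_comm rfl rfl

/-- `wsumD₂ (τᵀ) = wsumD₂ τ` for SYMMETRIC weights (the `e₁ - e₂` bonds of the transposed box are the
reversed `e₁ - e₂` bonds of the box). [cite: ValentiStolzeHirschfeld1991, §II] -/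
theorem wsumD₂_transpose (τ : Fin r ×ₗ Fin c → Fin r ×ₗ Fin c → ℝ) (hτ : ∀ x y, τ x y = τ y x) :
    wsumD₂ (fun p q : Fin c ×ₗ Fin r => τ (rectSwap c r p) (rectSwap c r q)) = wsumD₂ τ := by
  unfold wsumD₂
  rw [sum_sum_rectSwap, Finset.sum_comm]
  refine Finset.sum_congr rfl fun p _ => Finset.sum_congr rfl fun q _ => ?_
  rw [hτ]
  exact if_congr and_comm rfl rfl

/-- Reversal, `+e₁` bonds: for symmetric weights the total weight of the bonds `(i+1, j) → (i, j)` equals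
`wsumV τ`. [cite: ValentiStolzeHirschfeld1991, §II] -/
theorem wsumV_reverse (τ : Fin r ×ₗ Fin c → Fin r ×ₗ Fin c → ℝ) (hτ : ∀ x y, τ x y = τ y x) :
    (∑ p : Fin r ×ₗ Fin c, ∑ q : Fin r ×ₗ Fin c,
      if ((ofLex q).1 : ℕ) + 1 = (ofLex p).1 ∧ (ofLex p).2 = (ofLex q).2 then τ p q else 0) = wsumV τ := by
  unfold wsumV
  rw [Finset.sum_comm]
  refine Finset.sum_congr rfl fun p _ => Finset.sum_congr rfl fun q _ => ?_
  rw [hτ]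
  exact if_congr (and_congr Iff.rfl eq_comm) rfl rfl

/-- Reversal, `+e₂` bonds. [cite: ValentiStolzeHirschfeld1991, §II] -/
theorem wsumH_reverse (τ : Fin r ×ₗ Fin c → Fin r ×ₗ Fin c → ℝ) (hτ : ∀ x y, τ x y = τ y x) :
    (∑ p : Fin r ×ₗ Fin c, ∑ q : Fin r ×ₗ Fin c,
      if (ofLex p).1 = (ofLex q).1 ∧ ((ofLex q).2 : ℕ) + 1 = (ofLex p).2 then τ p q else 0) = wsumH τ := by
  unfold wsumH
  rw [Finset.sum_comm]
  refine Finset.sum_congr rfl fun p _ => Finset.sum_congr rfl fun q _ => ?_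
  rw [hτ]
  exact if_congr (and_congr eq_comm Iff.rfl) rfl rfl

/-- Reversal, `e₁ + e₂` bonds. [cite: ValentiStolzeHirschfeld1991, §II] -/
theorem wsumD₁_reverse (τ : Fin r ×ₗ Fin c → Fin r ×ₗ Fin c → ℝ) (hτ : ∀ x y, τ x y = τ y x) :
    (∑ p : Fin r ×ₗ Fin c, ∑ q : Fin r ×ₗ Fin c,
      if ((ofLex q).1 : ℕ) + 1 = (ofLex p).1 ∧ ((ofLex q).2 : ℕ) + 1 = (ofLex p).2 then τ p q else 0) = wsumD₁ τ := by
  unfold wsumD₁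
  rw [Finset.sum_comm]
  refine Finset.sum_congr rfl fun p _ => Finset.sum_congr rfl fun q _ => ?_
  rw [hτ]

/-- Reversal, `e₁ - e₂` bonds. [cite: ValentiStolzeHirschfeld1991, §II] -/
theorem wsumD₂_reverse (τ : Fin r ×ₗ Fin c → Fin r ×ₗ Fin c → ℝ) (hτ : ∀ x y, τ x y = τ y x) :
    (∑ p : Fin r ×ₗ Fin c, ∑ q : Fin r ×ₗ Fin c,
      if ((ofLex q).1 : ℕ) + 1 = (ofLex p).1 ∧ ((ofLex p).2 : ℕ) + 1 = (ofLex q).2 then τ p q else 0) = wsumD₂ τ := by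
  unfold wsumD₂
  rw [Finset.sum_comm]
  refine Finset.sum_congr rfl fun p _ => Finset.sum_congr rfl fun q _ => ?_
  rw [hτ]

end ClusterLowerBound

end Literature.MathematicalPhysics.QuantumLattice
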